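import Mathlib
import Summits.Ventures.PercRepro.TriangleCapFourBelowCrude

/-!
# PercRepro — FOUR BELOW THE DIAGONAL: THREE TRIANGLES (VERTEX-DISJOINT, A PATH, ONE SHARED VERTEX FROM `k = 12`,
THE WINDMILL FROM `k = 13`) AND FOUR TRIANGLES, BY THE CRUDE COUNT (p3, gen 39; part 121)

With `|T₃| = 18` (three distinct 3-cliques carrying every triangle: `six_mul_card_le_card_triangles3`,
`card_triangles3_le_eighteen_of_three`) the crude count `stability_four_of_transversal` needs
`|F| + 2k + 14 ≤ 2m` for the transversal pairs `F`; the density `2m ≥ 6k − 26` gives `2m − 2k − 14 ≥ 4k − 40`: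
* three vertex-disjoint triangles: `F = ∅`, every `k ≥ 10` (**`three_triangles_stability_four_of_disjoint`**);
* a path `T₁ ∩ T₂ = {t}`, `T₂ ∩ T₃ = {t′}`, `T₁ ∩ T₃ = ∅`: `F = ∅`, every `k ≥ 10` (**`…_of_path`**);
* one shared vertex: `|F| ≤ 6 ≤ 4k − 40` for `k ≥ 12` (**`…_of_one_shared_of_twelve`**);
* the windmill: `|F| ≤ 2 (k − 7) ≤ 4k − 40` for `k ≥ 13` (**`…_of_windmill_of_thirteen`**).
With `|T₃| = 24` and `|F| ≤ 2 (k − 9)` (gen 38's transversal bound) the count needs `|F| + 32 ≤ 2m`, true for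
every `k ≥ 10` (**`four_triangles_stability_four_of_ten`**).  Axioms: standard.
-/

namespace PercRepro

namespace TriangleCap

namespace C047

open Finset

variable {V : Type*} [Fintype V] [DecidableEq V]

/-- Three distinct 3-cliques carrying every triangle of a `K₄⁻`-free graph: `|T₃| = 18`. -/
theorem card_triangles3_eq_eighteen (D : SimpleGraph V) [DecidableRel D.Adj] (hK : K4mFree D)
    (T₁ T₂ T₃ : Finset V) (h₁ : T₁.card = 3) (h₂ : T₂.card = 3) (h₃ : T₃.card = 3)
    (hcl₁ : ∀ x ∈ T₁, ∀ y ∈ T₁, x ≠ y → D.Adj x y) (hcl₂ : ∀ x ∈ T₂, ∀ y ∈ T₂, x ≠ y → D.Adj x y)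
    (hcl₃ : ∀ x ∈ T₃, ∀ y ∈ T₃, x ≠ y → D.Adj x y) (hne12 : T₁ ≠ T₂) (hne13 : T₁ ≠ T₃) (hne23 : T₂ ≠ T₃)
    (hT : ∀ x y z, D.Adj x y → D.Adj x z → D.Adj y z →
      (x ∈ T₁ ∧ y ∈ T₁) ∨ (x ∈ T₂ ∧ y ∈ T₂) ∨ (x ∈ T₃ ∧ y ∈ T₃)) :
    (triangles3 D).card = 6 * 3 := by
  have hF : ({T₁, T₂, T₃} : Finset (Finset V)).card = 3 := by
    rw [card_insert_of_notMem, card_insert_of_notMem, card_singleton]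
    · rw [mem_singleton]; exact hne23
    · rw [mem_insert, mem_singleton, not_or]; exact ⟨hne12, hne13⟩
  have h18 := six_mul_card_le_card_triangles3 D {T₁, T₂, T₃} (by
    intro T hT'
    simp only [mem_insert, mem_singleton] at hT'
    rcases hT' with rfl | rfl | rfl
    · exact exists_triple_of_clique D h₁ hcl₁
    · exact exists_triple_of_clique D h₂ hcl₂
    · exact exists_triple_of_clique D h₃ hcl₃)
  rw [hF] at h18
  have h18' := card_triangles3_le_eighteen_of_three D T₁ T₂ T₃ h₁ h₂ h₃ hcl₁ hcl₂ hcl₃ hT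
    (fun x y z z' hxy hxz hyz hxz' hyz' => eq_of_common_nbr D hK hxy hxz hyz hxz' hyz')
  omega

omit [Fintype V] in
/-- Two 3-cliques meeting in at most one vertex are distinct. -/
theorem ne_of_inter_card_le_one {T T' : Finset V} (hT : T.card = 3) (h : (T ∩ T').card ≤ 1) : T ≠ T' := by
  intro heq
  rw [heq, inter_self] at h
  rw [heq] at hT
  omega

/-- **FOUR BELOW THE DIAGONAL, THREE VERTEX-DISJOINT TRIANGLES, `k ≥ 10`:** `K₄⁻`-free, `2m ≥ 6k − 26`, three
vertex-disjoint 3-cliques carrying every triangle ⇒ `Σ_v d(v)² + 4 (k − 5) ≤ m k`. -/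
theorem three_triangles_stability_four_of_disjoint (D : SimpleGraph V) [DecidableRel D.Adj] (hK : K4mFree D)
    (hk : 10 ≤ Fintype.card V) (hm : 6 * Fintype.card V ≤ 2 * D.edgeFinset.card + 26)
    (T₁ T₂ T₃ : Finset V) (h₁ : T₁.card = 3) (h₂ : T₂.card = 3) (h₃ : T₃.card = 3)
    (h12 : Disjoint T₁ T₂) (h13 : Disjoint T₁ T₃) (h23 : Disjoint T₂ T₃)
    (hcl₁ : ∀ x ∈ T₁, ∀ y ∈ T₁, x ≠ y → D.Adj x y) (hcl₂ : ∀ x ∈ T₂, ∀ y ∈ T₂, x ≠ y → D.Adj x y)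
    (hcl₃ : ∀ x ∈ T₃, ∀ y ∈ T₃, x ≠ y → D.Adj x y)
    (hT : ∀ x y z, D.Adj x y → D.Adj x z → D.Adj y z →
      (x ∈ T₁ ∧ y ∈ T₁) ∨ (x ∈ T₂ ∧ y ∈ T₂) ∨ (x ∈ T₃ ∧ y ∈ T₃)) :
    ∑ v, deg D v * deg D v + 4 * (Fintype.card V - 5) ≤ D.edgeFinset.card * Fintype.card V := by
  have hi12 : (T₁ ∩ T₂).card ≤ 1 := by rw [disjoint_iff_inter_eq_empty.mp h12, card_empty]; exact Nat.zero_le _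
  have hi13 : (T₁ ∩ T₃).card ≤ 1 := by rw [disjoint_iff_inter_eq_empty.mp h13, card_empty]; exact Nat.zero_le _
  have hi23 : (T₂ ∩ T₃).card ≤ 1 := by rw [disjoint_iff_inter_eq_empty.mp h23, card_empty]; exact Nat.zero_le _
  have hT3 := card_triangles3_eq_eighteen D hK T₁ T₂ T₃ h₁ h₂ h₃ hcl₁ hcl₂ hcl₃ (ne_of_inter_card_le_one h₁ hi12)
    (ne_of_inter_card_le_one h₁ hi13) (ne_of_inter_card_le_one h₂ hi23) hT
  have hF := transversal_eq_empty_of_three_disjoint D hK T₁ T₂ T₃ h₁ h₂ h₃ h12 h13 h23 hcl₁ hcl₂ hcl₃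
  apply stability_four_of_transversal D hK hk 3 hT3
  rw [hF, card_empty]
  omega

/-- **FOUR BELOW THE DIAGONAL, A PATH OF THREE TRIANGLES, `k ≥ 10`:** `T₁ ∩ T₂ = {t}`, `T₂ ∩ T₃ = {t′}`,
`T₁ ∩ T₃ = ∅`, carrying every triangle ⇒ `Σ_v d(v)² + 4 (k − 5) ≤ m k`. -/
theorem three_triangles_stability_four_of_path (D : SimpleGraph V) [DecidableRel D.Adj] (hK : K4mFree D)
    (hk : 10 ≤ Fintype.card V) (hm : 6 * Fintype.card V ≤ 2 * D.edgeFinset.card + 26)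
    (T₁ T₂ T₃ : Finset V) (h₁ : T₁.card = 3) (h₂ : T₂.card = 3) (h₃ : T₃.card = 3) {t t' : V}
    (h12 : T₁ ∩ T₂ = {t}) (h23 : T₂ ∩ T₃ = {t'}) (h13 : Disjoint T₁ T₃)
    (hcl₁ : ∀ x ∈ T₁, ∀ y ∈ T₁, x ≠ y → D.Adj x y) (hcl₂ : ∀ x ∈ T₂, ∀ y ∈ T₂, x ≠ y → D.Adj x y)
    (hcl₃ : ∀ x ∈ T₃, ∀ y ∈ T₃, x ≠ y → D.Adj x y)
    (hT : ∀ x y z, D.Adj x y → D.Adj x z → D.Adj y z →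
      (x ∈ T₁ ∧ y ∈ T₁) ∨ (x ∈ T₂ ∧ y ∈ T₂) ∨ (x ∈ T₃ ∧ y ∈ T₃)) :
    ∑ v, deg D v * deg D v + 4 * (Fintype.card V - 5) ≤ D.edgeFinset.card * Fintype.card V := by
  have hi12 : (T₁ ∩ T₂).card ≤ 1 := by rw [h12, card_singleton]
  have hi13 : (T₁ ∩ T₃).card ≤ 1 := by rw [disjoint_iff_inter_eq_empty.mp h13, card_empty]; exact Nat.zero_le _
  have hi23 : (T₂ ∩ T₃).card ≤ 1 := by rw [h23, card_singleton]
  have hT3 := card_triangles3_eq_eighteen D hK T₁ T₂ T₃ h₁ h₂ h₃ hcl₁ hcl₂ hcl₃ (ne_of_inter_card_le_one h₁ hi12)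
    (ne_of_inter_card_le_one h₁ hi13) (ne_of_inter_card_le_one h₂ hi23) hT
  have hF := transversal_eq_empty_of_path D hK T₁ T₂ T₃ h₁ h₂ h₃ h12 h23 h13 hcl₁ hcl₂ hcl₃ hT
  apply stability_four_of_transversal D hK hk 3 hT3
  rw [hF, card_empty]
  omega

/-- **FOUR BELOW THE DIAGONAL, THREE TRIANGLES WITH ONE SHARED VERTEX, `k ≥ 12`:** `T₁ ∩ T₂ = {t}`, `T₃` disjoint
from both, carrying every triangle ⇒ `Σ_v d(v)² + 4 (k − 5) ≤ m k`. -/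
theorem three_triangles_stability_four_of_one_shared_of_twelve (D : SimpleGraph V) [DecidableRel D.Adj]
    (hK : K4mFree D) (hk : 12 ≤ Fintype.card V) (hm : 6 * Fintype.card V ≤ 2 * D.edgeFinset.card + 26)
    (T₁ T₂ T₃ : Finset V) (h₁ : T₁.card = 3) (h₂ : T₂.card = 3) (h₃ : T₃.card = 3) {t : V}
    (h12 : T₁ ∩ T₂ = {t}) (h13 : Disjoint T₁ T₃) (h23 : Disjoint T₂ T₃)
    (hcl₁ : ∀ x ∈ T₁, ∀ y ∈ T₁, x ≠ y → D.Adj x y) (hcl₂ : ∀ x ∈ T₂, ∀ y ∈ T₂, x ≠ y → D.Adj x y)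
    (hcl₃ : ∀ x ∈ T₃, ∀ y ∈ T₃, x ≠ y → D.Adj x y)
    (hT : ∀ x y z, D.Adj x y → D.Adj x z → D.Adj y z →
      (x ∈ T₁ ∧ y ∈ T₁) ∨ (x ∈ T₂ ∧ y ∈ T₂) ∨ (x ∈ T₃ ∧ y ∈ T₃)) :
    ∑ v, deg D v * deg D v + 4 * (Fintype.card V - 5) ≤ D.edgeFinset.card * Fintype.card V := by
  have hi12 : (T₁ ∩ T₂).card ≤ 1 := by rw [h12, card_singleton]
  have hi13 : (T₁ ∩ T₃).card ≤ 1 := by rw [disjoint_iff_inter_eq_empty.mp h13, card_empty]; exact Nat.zero_le _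
  have hi23 : (T₂ ∩ T₃).card ≤ 1 := by rw [disjoint_iff_inter_eq_empty.mp h23, card_empty]; exact Nat.zero_le _
  have hT3 := card_triangles3_eq_eighteen D hK T₁ T₂ T₃ h₁ h₂ h₃ hcl₁ hcl₂ hcl₃ (ne_of_inter_card_le_one h₁ hi12)
    (ne_of_inter_card_le_one h₁ hi13) (ne_of_inter_card_le_one h₂ hi23) hT
  have hF := transversal_subset_of_one_shared D hK T₁ T₂ T₃ h₁ h₂ h₃ h12 h13 h23 hcl₁ hcl₂ hcl₃
  have hFc := card_le_card hF
  have hc : (({t} ×ˢ T₃) ∪ (T₃ ×ˢ {t})).card ≤ 6 := by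
    calc (({t} ×ˢ T₃) ∪ (T₃ ×ˢ {t})).card ≤ ({t} ×ˢ T₃).card + (T₃ ×ˢ {t}).card := card_union_le _ _
      _ = 6 := by rw [card_product, card_product, card_singleton, h₃]
  apply stability_four_of_transversal D hK (by omega) 3 hT3
  omega

/-- **FOUR BELOW THE DIAGONAL, THE WINDMILL, `k ≥ 13`:** three triangles pairwise meeting in `t`, carrying every
triangle ⇒ `Σ_v d(v)² + 4 (k − 5) ≤ m k`. -/
theorem three_triangles_stability_four_of_windmill_of_thirteen (D : SimpleGraph V) [DecidableRel D.Adj]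
    (hK : K4mFree D) (hk : 13 ≤ Fintype.card V) (hm : 6 * Fintype.card V ≤ 2 * D.edgeFinset.card + 26)
    (T₁ T₂ T₃ : Finset V) (h₁ : T₁.card = 3) (h₂ : T₂.card = 3) (h₃ : T₃.card = 3) {t : V}
    (h12 : T₁ ∩ T₂ = {t}) (h13 : T₁ ∩ T₃ = {t}) (h23 : T₂ ∩ T₃ = {t})
    (hcl₁ : ∀ x ∈ T₁, ∀ y ∈ T₁, x ≠ y → D.Adj x y) (hcl₂ : ∀ x ∈ T₂, ∀ y ∈ T₂, x ≠ y → D.Adj x y)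
    (hcl₃ : ∀ x ∈ T₃, ∀ y ∈ T₃, x ≠ y → D.Adj x y)
    (hT : ∀ x y z, D.Adj x y → D.Adj x z → D.Adj y z →
      (x ∈ T₁ ∧ y ∈ T₁) ∨ (x ∈ T₂ ∧ y ∈ T₂) ∨ (x ∈ T₃ ∧ y ∈ T₃)) :
    ∑ v, deg D v * deg D v + 4 * (Fintype.card V - 5) ≤ D.edgeFinset.card * Fintype.card V := by
  have hi12 : (T₁ ∩ T₂).card ≤ 1 := by rw [h12, card_singleton]
  have hi13 : (T₁ ∩ T₃).card ≤ 1 := by rw [h13, card_singleton]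
  have hi23 : (T₂ ∩ T₃).card ≤ 1 := by rw [h23, card_singleton]
  have hT3 := card_triangles3_eq_eighteen D hK T₁ T₂ T₃ h₁ h₂ h₃ hcl₁ hcl₂ hcl₃ (ne_of_inter_card_le_one h₁ hi12)
    (ne_of_inter_card_le_one h₁ hi13) (ne_of_inter_card_le_one h₂ hi23) hT
  have hF := transversal_subset_of_windmill D hK T₁ T₂ T₃ h₁ h₂ h₃ h12 h13 h23 hcl₁ hcl₂ hcl₃
  have hFc := card_le_card hF
  have hS : 7 ≤ (T₁ ∪ T₂ ∪ T₃).card := by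
    have ht1 : t ∈ T₁ := (mem_inter.mp (by rw [h12]; exact mem_singleton_self t)).1
    have hu : (T₁ ∪ T₂).card + (T₁ ∩ T₂).card = T₁.card + T₂.card := card_union_add_card_inter T₁ T₂
    have hu' : (T₁ ∪ T₂ ∪ T₃).card + ((T₁ ∪ T₂) ∩ T₃).card = (T₁ ∪ T₂).card + T₃.card :=
      card_union_add_card_inter (T₁ ∪ T₂) T₃
    have hi : ((T₁ ∪ T₂) ∩ T₃).card ≤ 1 := by
      rw [union_inter_distrib_right, h13, h23, union_self, card_singleton]
    rw [h12, card_singleton] at hu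
    omega
  have hc : (({t} ×ˢ (T₁ ∪ T₂ ∪ T₃)ᶜ) ∪ ((T₁ ∪ T₂ ∪ T₃)ᶜ ×ˢ {t})).card ≤ 2 * (Fintype.card V - 7) := by
    calc (({t} ×ˢ (T₁ ∪ T₂ ∪ T₃)ᶜ) ∪ ((T₁ ∪ T₂ ∪ T₃)ᶜ ×ˢ {t})).card ≤
        ({t} ×ˢ (T₁ ∪ T₂ ∪ T₃)ᶜ).card + ((T₁ ∪ T₂ ∪ T₃)ᶜ ×ˢ {t}).card := card_union_le _ _
      _ = 2 * (T₁ ∪ T₂ ∪ T₃)ᶜ.card := by rw [card_product, card_product, card_singleton]; ring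
      _ ≤ 2 * (Fintype.card V - 7) := by rw [card_compl]; omega
  apply stability_four_of_transversal D hK (by omega) 3 hT3
  omega

/-- **FOUR BELOW THE DIAGONAL, EXACTLY FOUR TRIANGLES, `k ≥ 10`:** `K₄⁻`-free, `2m ≥ 6k − 26`, four distinct
3-cliques carrying every triangle ⇒ `Σ_v d(v)² + 4 (k − 5) ≤ m k`. -/
theorem four_triangles_stability_four_of_ten (D : SimpleGraph V) [DecidableRel D.Adj] (hK : K4mFree D)
    (hk : 10 ≤ Fintype.card V) (hm : 6 * Fintype.card V ≤ 2 * D.edgeFinset.card + 26)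
    (T₁ T₂ T₃ T₄ : Finset V) (h₁ : T₁.card = 3) (h₂ : T₂.card = 3) (h₃ : T₃.card = 3) (h₄ : T₄.card = 3)
    (hcl₁ : ∀ x ∈ T₁, ∀ y ∈ T₁, x ≠ y → D.Adj x y) (hcl₂ : ∀ x ∈ T₂, ∀ y ∈ T₂, x ≠ y → D.Adj x y)
    (hcl₃ : ∀ x ∈ T₃, ∀ y ∈ T₃, x ≠ y → D.Adj x y) (hcl₄ : ∀ x ∈ T₄, ∀ y ∈ T₄, x ≠ y → D.Adj x y)
    (hne12 : T₁ ≠ T₂) (hne13 : T₁ ≠ T₃) (hne14 : T₁ ≠ T₄) (hne23 : T₂ ≠ T₃) (hne24 : T₂ ≠ T₄) (hne34 : T₃ ≠ T₄)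
    (hT : ∀ x y z, D.Adj x y → D.Adj x z → D.Adj y z →
      (x ∈ T₁ ∧ y ∈ T₁) ∨ (x ∈ T₂ ∧ y ∈ T₂) ∨ (x ∈ T₃ ∧ y ∈ T₃) ∨ (x ∈ T₄ ∧ y ∈ T₄)) :
    ∑ v, deg D v * deg D v + 4 * (Fintype.card V - 5) ≤ D.edgeFinset.card * Fintype.card V := by
  have h12 := inter_card_le_one_of_ne D hK h₁ h₂ hcl₁ hcl₂ hne12
  have h13 := inter_card_le_one_of_ne D hK h₁ h₃ hcl₁ hcl₃ hne13
  have h14 := inter_card_le_one_of_ne D hK h₁ h₄ hcl₁ hcl₄ hne14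
  have h23 := inter_card_le_one_of_ne D hK h₂ h₃ hcl₂ hcl₃ hne23
  have h24 := inter_card_le_one_of_ne D hK h₂ h₄ hcl₂ hcl₄ hne24
  have h34 := inter_card_le_one_of_ne D hK h₃ h₄ hcl₃ hcl₄ hne34
  have hF : ({T₁, T₂, T₃, T₄} : Finset (Finset V)).card = 4 := by
    rw [card_insert_of_notMem, card_insert_of_notMem, card_insert_of_notMem, card_singleton]
    · rw [mem_singleton]; exact hne34
    · rw [mem_insert, mem_singleton, not_or]; exact ⟨hne23, hne24⟩
    · rw [mem_insert, mem_insert, mem_singleton, not_or, not_or]; exact ⟨hne12, hne13, hne14⟩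
  have h24T := six_mul_card_le_card_triangles3 D {T₁, T₂, T₃, T₄} (by
    intro T hT'
    simp only [mem_insert, mem_singleton] at hT'
    rcases hT' with rfl | rfl | rfl | rfl
    · exact exists_triple_of_clique D h₁ hcl₁
    · exact exists_triple_of_clique D h₂ hcl₂
    · exact exists_triple_of_clique D h₃ hcl₃
    · exact exists_triple_of_clique D h₄ hcl₄)
  rw [hF] at h24T
  have h24' := card_triangles3_le_twentyfour_of_four D T₁ T₂ T₃ T₄ h₁ h₂ h₃ h₄ hcl₁ hcl₂ hcl₃ hcl₄ hT
    (fun x y z z' hxy hxz hyz hxz' hyz' => eq_of_common_nbr D hK hxy hxz hyz hxz' hyz')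
  have hT3 : (triangles3 D).card = 6 * 4 := by omega
  have htr := card_transversal_le_two_mul D hK T₁ T₂ T₃ T₄ h₁ h₂ h₃ h₄ hcl₁ hcl₂ hcl₃ hcl₄ h12 h13 h14 h23 h24
    h34 hk
  apply stability_four_of_transversal D hK hk 4 hT3
  omega

end C047

end TriangleCap

end PercRepro
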